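import Summits.BirchSwinnertonDyer.BirchSwinnertonDyer.Theorems.KolyvaginDepthDoorDepthTableKuriharaDecisivePrime
import Summits.BirchSwinnertonDyer.BirchSwinnertonDyer.Theorems.KolyvaginDepthDoorDepthTableKuriharaSocket718b1
import Summits.BirchSwinnertonDyer.Rank1Residual.Supersingular.CountPointsFast
import HarnessLib

/-!
# Route `KolyvaginDepthDoor`, crux `KolyvaginDepthSupplyKN` (stmt-BirchSwinnertonDyer-22820) —
# DEPTH TABLE v19, ROW `718b1` @ `(13, d_K = -7)`: THE DECISIVE PRIME `ℓ★ = 859` — the row's bit ⟺ a unit mod-`13`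
# Kurihara number of the twist model `T₀ = [1, 1, 0, -221, -307]` AT THE ONE PRIME `859` (kernel: `70 • P̄ ≠ O` in `T̃₀(𝔽_859)` for
# `P = (22, 67)`, `#T̃₀(𝔽_859) = 910 = 13·70`)

Helper file of the lead prover of line `levelone` (kdd-p1 g23; `--supports stmt-BirchSwinnertonDyer-22820
--as helper`); it closes nothing and BSD is NOT proved by it. Same template as `…KuriharaDecisive709a1`.

v18 (g22, `…KuriharaSocket718b1`) read the row EXACTLY as «bit ⟺ SOME cyclic Kolyvagin prime `ℓ` of `(T₀, 13)` carries
a unit `δ̃_ℓ(T₀)`», and CLOSING-DATA-v18 §2b marked `ℓ = 859` with ★ (the known point `P = (22, 67)` of `T₀` is not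
divisible by `13` in `T̃₀(𝔽_859)` — a heuristic there). v19 makes the ★ a THEOREM-LEVEL statement: by the generic
`…KuriharaDecisivePrime` (Sakamoto 2022 Lemma 4.4 + Lemma 4.6 (1) BY NAME, `hSak3`), the bit — which gives `#Sel_13(E^{(-7)}) ≤ 13`
by the row's exact reading — FORCES `δ̃_859(T₀) ≢ 0 (mod 13)`, the local `13`-indivisibility of `P` at `859` being
KERNEL-CHECKED here (`minTwist7_localNondivisible_859`: an affine double-and-add chain of 8 certified steps reaching
`70 • P̄ = (738, 22) ≠ O` in `T̃₀(𝔽_859)` by `decide`, `13·70 = #T̃₀(𝔽_859) = 910`, and the bridge `localNondivisible_of_chainB`).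
Conversely a unit at `859` closes the row by the socket. HENCE

* `twistKuriharaBit_iff_unit_859` — **bit ⟺ unit `δ̃_859(T₀)`** (for every admissible datum of `T₀`): the fleet's ONE
  residue `δ̃_859(T₀) mod 13` DECIDES the row `718b1` @ `(13, -7)` BOTH WAYS modulo print — a computed ZERO refutes the
  crux's clause at `(13, ℚ(√-7))` for `718b1` (the row then moves to another admissible prime / Heegner field), a UNIT proves it.

Kernel lemmas: `minTwist7_card_859` (`#T̃₀(𝔽_859) = 910`, `a_859(T₀) = -50 ≡ 2 (mod 13)`), `minTwist7_isCyclicKolyvaginLevel_13_859`,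
`minTwist7_localNondivisible_859`. CONDITIONAL on the named facts displayed and the E-side record claim `hδE`; per curve; nothing
class-wide; BSD is NOT proved by any of this.

References: [Sakamoto2022pSelmer] Lemma 4.4, Lemma 4.6 (1), Thm. 1.2, Thm. 1.5; [Kim2022StructureSelmer] Thm. 1.11;
[Kurihara2014] §5.3; [SilvermanAEC2009] III.2.3, VII.2.1, VII.3.1; [CremonaAlgorithms1997] Table 1 (718b1).
-/

set_option linter.dupNamespace false

noncomputable section

open scoped Classical NumberField

namespace Summit.BirchSwinnertonDyer.BirchSwinnertonDyer.Theorems.KolyvaginDepthDoor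

open Literature.NumberTheory.EllipticCurves Literature.NumberTheory.EllipticCurves.ModularForms
  WeierstrassCurve NumberField IsDedekindDomain
open Summit.BirchSwinnertonDyer.BirchSwinnertonDyer.Theorems
open Summit.BirchSwinnertonDyer.BirchSwinnertonDyer.Rank2Observatory
open Summit.BirchSwinnertonDyer.BirchSwinnertonDyer.Rank1Residual (IntModel.frobeniusTrace_eq)
open Summit.BirchSwinnertonDyer.Rank1Residual.Supersingular (natCard_point_eq_of_countPoints countPoints_eq_of_fast)
open Summit.BirchSwinnertonDyer.Rank1Residual.Additive (card_torsion_le_of_intModel_of_card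
  isKolyvaginPrime_of_intModel_of_card)

namespace C718b1

/-- `#T̃₀(𝔽_859) = 910 = 13·70` for `T₀ = [1, 1, 0, -221, -307]` (`859 ≡ 1 (mod 13)`, `a_859(T₀) = -50 ≡ 2 (mod 13)`, `13² ∤ 910`),
kernel-decided (`countPointsFast`). [cite: Kim2022StructureSelmer, §1.2.2 (PDF p. 5)] -/
theorem minTwist7_card_859 :
    Nat.card (((⟨1, 1, 0, -221, -307⟩ : WeierstrassCurve ℤ).map (Int.castRingHom (ZMod 859))).toAffine.Point) = 910 :=
  haveI : Fact (Nat.Prime 859) := ⟨by norm_num⟩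
  natCard_point_eq_of_countPoints 1 1 0 (-221) (-307) 859 (by norm_num) (by decide +kernel) (n := 910)
    (countPoints_eq_of_fast (by decide +kernel))

/-- **`859` is a CYCLIC KOLYVAGIN PRIME for `(T₀, 13)`** (`859 ∤ 13·N_{T₀}`, `859 ≡ 1`, `a_859(T₀) ≡ 2 (mod 13)`,
`#T̃₀(𝔽_859)[13] ≤ 13`) — a ★ candidate of CLOSING-DATA-v18 §2b. [cite: Kim2022StructureSelmer, §1.2.2 (PDF p. 5)] -/
theorem minTwist7_isCyclicKolyvaginLevel_13_859 :
    haveI := minTwist7_isGloballyMinimal; haveI := Fact.mk (by norm_num : Nat.Prime 13);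
    IsCyclicKolyvaginLevel ((⟨1, 1, 0, -221, -307⟩ : WeierstrassCurve ℤ).map (Int.castRingHom ℚ)) 13 859 := by
  haveI := minTwist7_isElliptic
  haveI := minTwist7_isGloballyMinimal
  haveI := Fact.mk (by norm_num : Nat.Prime 13)
  haveI : Fact (Nat.Prime 859) := ⟨by norm_num⟩
  have hℓ : Kato.IsKolyvaginPrime ((⟨1, 1, 0, -221, -307⟩ : WeierstrassCurve ℤ).map (Int.castRingHom ℚ)) 13 1 859 :=
    isKolyvaginPrime_of_intModel_of_card minTwist7_intModel 13 1 859 (by norm_num) (by decide +kernel) (by decide)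
      minTwist7_card_859 (by norm_num)
  refine ⟨⟨Nat.squarefree_iff_nodup_primeFactorsList (by norm_num) |>.mpr (by simp), fun ℓ hℓ' ↦ ?_⟩, fun ℓ hℓ' hdvd ↦ ?_⟩
  · rw [show (859 : ℕ).primeFactors = {859} from (Nat.Prime.primeFactors (by norm_num)), Finset.mem_singleton] at hℓ'
    exact hℓ' ▸ hℓ
  · obtain rfl := (Nat.prime_dvd_prime_iff_eq hℓ'.out (by norm_num)).mp hdvd
    exact card_torsion_le_of_intModel_of_card minTwist7_intModel 13 859 minTwist7_card_859 (by norm_num)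

/-- The rational point `P = (22, 67)` of `T₀ = [1, 1, 0, -221, -307]` (integral; on the curve). [folklore] -/
theorem minTwist7_nonsingular_P :
    ((⟨1, 1, 0, -221, -307⟩ : WeierstrassCurve ℤ).map (Int.castRingHom ℚ)).toAffine.Nonsingular ((22 : ℤ) : ℚ) ((67 : ℤ) : ℚ) :=
  nonsingular_rat_of_eq _ (by decide +kernel) (by norm_num)

/-- The double-and-add chain from `P̄` reaches the multiplier `70`. [folklore] -/
theorem chain859_mult :
    chainMult 1 [(true, ((627 : ℤ) : ZMod 859), ((524 : ℤ) : ZMod 859)), (true, ((600 : ℤ) : ZMod 859), ((247 : ℤ) : ZMod 859)), (true, ((835 : ℤ) : ZMod 859), ((526 : ℤ) : ZMod 859)), (true, ((123 : ℤ) : ZMod 859), ((659 : ℤ) : ZMod 859)), (false, ((363 : ℤ) : ZMod 859), ((548 : ℤ) : ZMod 859)), (true, ((616 : ℤ) : ZMod 859), ((370 : ℤ) : ZMod 859)), (false, ((541 : ℤ) : ZMod 859), ((624 : ℤ) : ZMod 859)), (true, ((738 : ℤ) : ZMod 859), ((22 : ℤ) : ZMod 859))] = 70 := by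
  decide

/-- The double-and-add chain from `P̄ = (22, 67)` to `70 • P̄ = (738, 22)` in `T̃₀(𝔽_859)` CHECKS (tangent / chord
certificates, `decide`). [cite: SilvermanAEC2009, III.2.3] -/
theorem chain859_ok :
    chainB (⟨1, 1, 0, -221, -307⟩ : WeierstrassCurve ℤ) 859 (((22 : ℤ)) : ZMod 859) (((67 : ℤ)) : ZMod 859)
      ((((22 : ℤ)) : ZMod 859), (((67 : ℤ)) : ZMod 859))
      [(true, ((627 : ℤ) : ZMod 859), ((524 : ℤ) : ZMod 859)), (true, ((600 : ℤ) : ZMod 859), ((247 : ℤ) : ZMod 859)), (true, ((835 : ℤ) : ZMod 859), ((526 : ℤ) : ZMod 859)), (true, ((123 : ℤ) : ZMod 859), ((659 : ℤ) : ZMod 859)), (false, ((363 : ℤ) : ZMod 859), ((548 : ℤ) : ZMod 859)), (true, ((616 : ℤ) : ZMod 859), ((370 : ℤ) : ZMod 859)), (false, ((541 : ℤ) : ZMod 859), ((624 : ℤ) : ZMod 859)), (true, ((738 : ℤ) : ZMod 859), ((22 : ℤ) : ZMod 859))] = true := by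
  decide +kernel

/-- **KERNEL: `P = (22, 67)` is not divisible by `13` in `T₀(ℚ_859)`** — the chain certifies `70 • P̄ ≠ O` in `T̃₀(𝔽_859)`,
`13·70 = #T̃₀(𝔽_859)`, and `localNondivisible_of_chainB`. This is the ★ of CLOSING-DATA-v18 §2b for `718b1` at `859`, now in
the kernel. [cite: SilvermanAEC2009, III.2.3, VII.2 Prop. 2.1, VII.3 Prop. 3.1] -/
theorem minTwist7_localNondivisible_859 :
    haveI : Fact (Nat.Prime 859) := ⟨by norm_num⟩;
    ∀ Q : (((⟨1, 1, 0, -221, -307⟩ : WeierstrassCurve ℤ).map (Int.castRingHom ℚ)).baseChange ℚ_[859]).toAffine.Point,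
      13 • Q ≠ WeierstrassCurve.Affine.Point.map (W' := ((⟨1, 1, 0, -221, -307⟩ : WeierstrassCurve ℤ).map (Int.castRingHom ℚ)).toAffine)
        (S := ℚ) (Algebra.ofId ℚ ℚ_[859]) (.some ((22 : ℤ) : ℚ) ((67 : ℤ) : ℚ) minTwist7_nonsingular_P) := by
  haveI : Fact (Nat.Prime 859) := ⟨by norm_num⟩
  have hq : ¬ ((859 : ℕ) : ℤ) ∣ (⟨1, 1, 0, -221, -307⟩ : WeierstrassCurve ℤ).Δ := by decide +kernel
  have hXY : (⟨1, 1, 0, -221, -307⟩ : WeierstrassCurve ℤ).toAffine.Equation (22) (67) :=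
    (Affine.equation_iff _ _).mpr (by norm_num)
  have hpk : 13 * 70 = Nat.card (((⟨1, 1, 0, -221, -307⟩ : WeierstrassCurve ℤ).map (Int.castRingHom (ZMod 859))).toAffine.Point) := by
    rw [minTwist7_card_859]
  exact localNondivisible_of_chainB (⟨1, 1, 0, -221, -307⟩ : WeierstrassCurve ℤ) 859 hq hXY minTwist7_nonsingular_P hpk
    chain859_mult (by convert chain859_ok)

/-- **ROW `718b1` @ `(13, -7)`: THE DECISIVE PRIME `859` — bit ⟺ unit `δ̃_859(T₀)`.** For every imaginary quadratic `K`
with `d_K = -7`, granted the named facts displayed and the E-side record claim `hδE`: «some frame, some Kolyvagin PRIME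
`ℓ`, some Kolyvagin–Heegner datum of conductor `ℓ` with `c_1(ℓ) ≠ 0`» (the depth-table bit) holds IF AND ONLY IF «every
datum `D` of `T₀` at level `N_{T₀}` with `13 ∤ c_D` and the period transfer has a UNIT mod-`13` Kurihara number AT `859`» —
the claim of a future tree record `cert_<T₀>` @ `(13, 859)`. (⟹): bit ⟹ `#Sel_13(E^{(-7)}) ≤ 13` (the socket's exact reading
∘ v18's twist IFF) ⟹ unit at `859` (`twistKuriharaClaim_prime_of_natCard_selmerGroup_le` with the kernel certificate
`minTwist7_localNondivisible_859`); (⟸): the exact reading with `m = 859` (`minTwist7_isCyclicKolyvaginLevel_13_859`, `ν(859) = 1`).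
CONDITIONAL on the named facts and the claim; per curve; BSD is not proved by it.
[cite: Sakamoto2022pSelmer, Lemma 4.4, Lemma 4.6 (1), Thm. 1.2, Thm. 1.5] [cite: Kim2022StructureSelmer, Thm. 1.11]
[cite: CremonaAlgorithms1997, Table 1 (718b1)] -/
theorem twistKuriharaBit_iff_unit_859
    (h372 : GrossLMS1991.prop37_2_frobeniusCongruence)
    (h84 : Literature.NumberTheory.EllipticCurves.WZhang2014_lemma84_exists_minimal_kolyvaginClass_one_selmerCard)
    (hKim : Kim2022_card_selmerGroup_le_pow_of_kuriharaNumber_ne_zero)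
    (hSak1 : Sakamoto2022_card_selmerGroup_eq_pow_of_isDeltaMinimal)
    (hSak2 : Sakamoto2022_exists_cyclicLevel_kuriharaNumber_ne_zero)
    (hSak3 : Literature.NumberTheory.EllipticCurves.Sakamoto2022_kuriharaNumber_prime_ne_zero_of_localNondivisible)
    (hnf : exists_isNewformOf) (hMaz : mazur_not_dvd_maninConstant_of_odd)
    (K : Type) [Field K] [NumberField K] (hK : IsImaginaryQuadratic K) (hD : NumberField.discr K = -7)
    (hδE : haveI := isElliptic_c718b1; haveI := isGloballyMinimal_c718b1;
      haveI : NeZero (((⟨1, 0, 1, -5, 0⟩ : WeierstrassCurve ℤ).map (Int.castRingHom ℚ)).conductorNorm ℤ) := neZero_conductorNorm_of_isElliptic _;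
      haveI := Fact.mk (by norm_num : Nat.Prime 13);
      ∀ (D : ModularParametrizationData ((⟨1, 0, 1, -5, 0⟩ : WeierstrassCurve ℤ).map (Int.castRingHom ℚ)) (((⟨1, 0, 1, -5, 0⟩ : WeierstrassCurve ℤ).map (Int.castRingHom ℚ)).conductorNorm ℤ)), ¬ ((13 : ℕ) : ℤ) ∣ D.maninConstant →
        (∃ u : ℚ, ‖(u : ℚ_[13])‖ = 1 ∧ ((⟨1, 0, 1, -5, 0⟩ : WeierstrassCurve ℤ).map (Int.castRingHom ℚ)).realPeriodRat = u * plusPeriod D.f) →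
        ∃ ψ : (ℓ : ℕ) → (ZMod ℓ)ˣ →* Multiplicative (ZMod 13),
          (∀ ℓ ∈ (1682617 : ℕ).primeFactors, Function.Surjective (ψ ℓ)) ∧ kuriharaNumber D.f 13 1682617 ψ ≠ 0) :
    haveI := isElliptic_c718b1; haveI := isGloballyMinimal_c718b1;
    haveI : NeZero (((⟨1, 0, 1, -5, 0⟩ : WeierstrassCurve ℤ).map (Int.castRingHom ℚ)).conductorNorm ℤ) := neZero_conductorNorm_of_isElliptic _;
    haveI := minTwist7_isElliptic; haveI := minTwist7_isGloballyMinimal;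
    haveI : NeZero (((⟨1, 1, 0, -221, -307⟩ : WeierstrassCurve ℤ).map (Int.castRingHom ℚ)).conductorNorm ℤ) := neZero_conductorNorm_of_isElliptic _;
    haveI := Fact.mk (by norm_num : Nat.Prime 13);
    (∃ (Dt : ModularParametrizationData ((⟨1, 0, 1, -5, 0⟩ : WeierstrassCurve ℤ).map (Int.castRingHom ℚ)) (((⟨1, 0, 1, -5, 0⟩ : WeierstrassCurve ℤ).map (Int.castRingHom ℚ)).conductorNorm ℤ)) (β : ℤ)
      (ι : K →+* ℂ) (ℓ : ℕ) (d : KolyvaginHeegnerData Dt β ι ℓ),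
      ℓ.Prime ∧ Zhang2014.IsKolyvaginPrime (((⟨1, 0, 1, -5, 0⟩ : WeierstrassCurve ℤ).map (Int.castRingHom ℚ)).conductorNorm ℤ) ((⟨1, 0, 1, -5, 0⟩ : WeierstrassCurve ℤ).map (Int.castRingHom ℚ)) K 13 ℓ ∧
        d.kolyvaginClass (p := 13) (by norm_num) 1 ≠ 0) ↔
    (∀ (D : ModularParametrizationData ((⟨1, 1, 0, -221, -307⟩ : WeierstrassCurve ℤ).map (Int.castRingHom ℚ))
          (((⟨1, 1, 0, -221, -307⟩ : WeierstrassCurve ℤ).map (Int.castRingHom ℚ)).conductorNorm ℤ)),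
        ¬ ((13 : ℕ) : ℤ) ∣ D.maninConstant →
        (∃ u : ℚ, ‖(u : ℚ_[13])‖ = 1 ∧
          ((⟨1, 1, 0, -221, -307⟩ : WeierstrassCurve ℤ).map (Int.castRingHom ℚ)).realPeriodRat = u * plusPeriod D.f) →
        ∃ ψ : (q : ℕ) → (ZMod q)ˣ →* Multiplicative (ZMod 13),
          (∀ q ∈ (859 : ℕ).primeFactors, Function.Surjective (ψ q)) ∧ kuriharaNumber D.f 13 859 ψ ≠ 0) := by
  haveI := isElliptic_c718b1
  haveI := isGloballyMinimal_c718b1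
  haveI iNZ : NeZero (((⟨1, 0, 1, -5, 0⟩ : WeierstrassCurve ℤ).map (Int.castRingHom ℚ)).conductorNorm ℤ) :=
    neZero_conductorNorm_of_isElliptic _
  haveI := minTwist7_isElliptic
  haveI := minTwist7_isGloballyMinimal
  haveI iNZT : NeZero (((⟨1, 1, 0, -221, -307⟩ : WeierstrassCurve ℤ).map (Int.castRingHom ℚ)).conductorNorm ℤ) :=
    neZero_conductorNorm_of_isElliptic _
  haveI iP := Fact.mk (by norm_num : Nat.Prime 13)
  haveI : Fact (Nat.Prime 859) := ⟨by norm_num⟩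
  haveI : NeZero (859 : ℕ) := ⟨by norm_num⟩
  have hsur : ((⟨1, 0, 1, -5, 0⟩ : WeierstrassCurve ℤ).map (Int.castRingHom ℚ)).HasSurjectiveModNGaloisRep ((13 : ℕ) : ℤ) := by
    simpa using hasSurjectiveModNGaloisRep_13
  have htower : ∀ k : ℕ, ((⟨1, 0, 1, -5, 0⟩ : WeierstrassCurve ℤ).map (Int.castRingHom ℚ)).HasSurjectiveModNGaloisRep ((13 : ℕ) ^ k : ℕ) :=
    serre_hasSurjectiveModNGaloisRep_pow_holds _ 13 (by norm_num) hsur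
  have hsp := spadeOne_of_five_le 13 (by norm_num)
  have hS2 : ¬ Squarefree (((⟨1, 0, 1, -5, 0⟩ : WeierstrassCurve ℤ).map (Int.castRingHom ℚ)).conductorNorm ℤ) →
      (∃ (ℓ : ℕ) (_ : Fact ℓ.Prime), ((⟨1, 0, 1, -5, 0⟩ : WeierstrassCurve ℤ).map (Int.castRingHom ℚ)).HasMultiplicativeReductionAtPrime ℓ ∧
          ¬ 13 ∣ padicValInt ℓ ((⟨1, 0, 1, -5, 0⟩ : WeierstrassCurve ℤ).map (Int.castRingHom ℚ)).minimalDiscriminantInt) ∧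
        ∃ (ℓ₁ ℓ₂ : ℕ) (_ : Fact ℓ₁.Prime) (_ : Fact ℓ₂.Prime), ℓ₁ ≠ ℓ₂ ∧
          ((⟨1, 0, 1, -5, 0⟩ : WeierstrassCurve ℤ).map (Int.castRingHom ℚ)).HasMultiplicativeReductionAtPrime ℓ₁ ∧
          ((⟨1, 0, 1, -5, 0⟩ : WeierstrassCurve ℤ).map (Int.castRingHom ℚ)).HasMultiplicativeReductionAtPrime ℓ₂ :=
    fun hns ↦ absurd ((((⟨1, 0, 1, -5, 0⟩ : WeierstrassCurve ℤ).map (Int.castRingHom ℚ))).isSemistable_iff_squarefree_conductorNorm.mp hsp.2) hns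
  have hH := satisfiesHeegnerHypothesis_conductorNorm_of_intModel intModel K hK.1 hD heegner_neg7
  have hD3 : NumberField.discr K ≠ -3 := by rw [hD]; norm_num
  have hD4 : NumberField.discr K ≠ -4 := by rw [hD]; norm_num
  have hpD : ¬ (((13 : ℕ) : ℤ) ∣ NumberField.discr K) := by rw [hD]; decide
  have hC : (⟨1, (-1 : ℚ), -((1 : ℚ) / 2), (1 : ℚ) / 2⟩ : WeierstrassCurve.VariableChange ℚ) •
      ((⟨1, 1, 0, -221, -307⟩ : WeierstrassCurve ℤ).map (Int.castRingHom ℚ)) =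
      ((⟨1, 0, 1, -5, 0⟩ : WeierstrassCurve ℤ).map (Int.castRingHom ℚ)).quadraticTwist ((NumberField.discr K : ℤ) : ℚ) := by
    rw [hD]; push_cast; exact minTwist7_smul_eq
  have hr2 := Summit.BirchSwinnertonDyer.BirchSwinnertonDyer.Rank2Observatory.C718b1.mordellWeilRank_eq_two
  have hiff := kolyvaginPrime_iff_twistKuriharaBit_13_neg7 h372 h84 hKim hSak1 hSak2 hnf hMaz K hK hD hδE
  constructor
  · intro hbit D hc hu
    have hT := (natCard_selmerGroup_quadraticTwist_le_iff_kuriharaBit hKim hSak1 hSak2 hnf hMaz _ 13 (by norm_num) goodOrdinary_13.1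
      goodOrdinary_13.2 hsur (NumberField.discr_ne_zero K) hpD _ _ hC minTwist7_nonAnomalous_13 (minTwist7_kodairaNeron_of_five_le 13 (by norm_num)) 1).mpr (hiff.mp hbit)
    rw [pow_one] at hT
    exact twistKuriharaClaim_prime_of_natCard_selmerGroup_le hSak3 _ 13 (by norm_num) goodOrdinary_13.1 goodOrdinary_13.2 hsur
      (NumberField.discr_ne_zero K) hpD _ _ hC minTwist7_nonAnomalous_13 (minTwist7_kodairaNeron_of_five_le 13 (by norm_num)) hT 859
      minTwist7_isCyclicKolyvaginLevel_13_859 _ minTwist7_localNondivisible_859 D hc hu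
  · intro hunit
    refine hiff.mpr fun D hc hu ↦ ?_
    obtain ⟨ψ, hψ, hne⟩ := hunit D hc hu
    refine ⟨859, inferInstance, minTwist7_isCyclicKolyvaginLevel_13_859, ?_, ψ, hψ, hne⟩
    rw [Nat.Prime.primeFactors (by norm_num), Finset.card_singleton]

end C718b1

end Summit.BirchSwinnertonDyer.BirchSwinnertonDyer.Theorems.KolyvaginDepthDoor

end
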